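import Literature.NumberTheory.Transcendental.CurvePeriods
import Mathlib.Analysis.SpecialFunctions.Pow.Deriv
import Mathlib.Analysis.Complex.RealDeriv

/-!
# `BetaLinearSector` (stmt-KontsevichZagierPeriods-3897), line `fermat-sector-transport`:
# stub `stub_fermatIntegrand` — the arc integrand on the Fermat curve

On the affine Fermat curve `F_N : x^N + y^N = 1` consider the radial arc
`γ_N(t) = ((1 − t)·λ(t), t·λ(t))`, `λ = Q^{−1/N}`, `Q(t) = (1 − t)^N + t^N`, and Rohrlich's
polynomial 1-form `ω_{r,s} = x^{r−1} y^{s} dx − x^{r} y^{s−1} dy = x^{r−1} y^{s−1} (y dx − x dy)`.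
Along the arc `y x′ − x y′ = t λ (−λ + (1 − t) λ′) − (1 − t) λ (λ + t λ′) = −λ²` (the `λ′`-terms
cancel), so the integrand of the period `∫_γ ω` at an interior time `t ∈ (0,1)` is

  `Σᵢ ωᵢ(γ(t)) γᵢ′(t) = −x^{r−1} y^{s−1} λ² = −(1 − t)^{r−1} t^{s−1} Q(t)^{−(r+s)/N}`.

Only the formula for `γ.toFun` is used (not the `CurvePath` fields). Mathlib calculus only:
`HasDerivAt.rpow_const`, `HasDerivAt.ofReal_comp`, `Real.rpow_mul`, `Real.rpow_natCast`.
-/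

noncomputable section

open scoped BigOperators
open Set MvPolynomial
open Literature.NumberTheory.Transcendental Literature.NumberTheory.Transcendental.CurvePeriods

namespace Summit.KontsevichZagierPeriods.FermatIsogeny.BetaLinearSector

/-- **The arc integrand (Fermat stub 2).** Along the radial arc
`γ_N(t) = ((1 − t) Q(t)^{−1/N}, t Q(t)^{−1/N})`, `Q(t) = (1 − t)^N + t^N`, of the Fermat curve
`x^N + y^N = 1`, Rohrlich's polynomial form `ω_{r,s} = x^{r−1} y^{s} dx − x^{r} y^{s−1} dy`
evaluates at `t ∈ (0,1)` to `−(1 − t)^{r−1} t^{s−1} Q(t)^{−(r+s)/N}` (the derivative of `Q^{−1/N}`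
cancels in `y x′ − x y′ = −Q^{−2/N}`). [cite: Gross1978, §1 (Rohrlich's appendix)] -/
theorem stub_fermatIntegrand : ∀ (N r s : ℕ), 1 ≤ N → 1 ≤ r → 1 ≤ s →
    ∀ γ : CurvePath (⟨2, 1, ![X 0 ^ N + X 1 ^ N - 1]⟩ : CurveData),
    (∀ t : ℝ, γ.toFun t = ![(((1 - t) * ((1 - t) ^ N + t ^ N) ^ (-(1:ℝ) / N) : ℝ) : ℂ),
        ((t * ((1 - t) ^ N + t ^ N) ^ (-(1:ℝ) / N) : ℝ) : ℂ)]) →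
    ∀ t ∈ Set.Ioo (0:ℝ) 1,
      (∑ i, MvPolynomial.eval (γ.toFun t)
          ((![X 0 ^ (r - 1) * X 1 ^ s, -(X 0 ^ r * X 1 ^ (s - 1))] : Fin 2 → MvPolynomial (Fin 2) ℂ) i) *
        deriv (fun u => γ.toFun u i) t) =
      ((-((1 - t) ^ (r - 1) * t ^ (s - 1) * ((1 - t) ^ N + t ^ N) ^ (-((r:ℝ) + s) / N)) : ℝ) : ℂ) := by
  intro N r s _hN hr hs γ hγ t ht
  obtain ⟨r, rfl⟩ : ∃ r', r = r' + 1 := ⟨r - 1, by omega⟩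
  obtain ⟨s, rfl⟩ : ∃ s', s = s' + 1 := ⟨s - 1, by omega⟩
  simp only [Nat.add_sub_cancel]
  -- `Q(t) > 0` on `(0,1)`
  have hQpos : 0 < (1 - t) ^ N + t ^ N :=
    add_pos (pow_pos (by linarith [ht.2]) N) (pow_pos ht.1 N)
  -- the derivative of `Q` and (only its existence matters) of `λ = Q^{-1/N}` at `t`
  have hQ : HasDerivAt (fun u : ℝ => (1 - u) ^ N + u ^ N)
      ((N : ℝ) * (1 - t) ^ (N - 1) * (-1) + (N : ℝ) * t ^ (N - 1)) t :=
    (((hasDerivAt_id' (x := t)).const_sub 1).fun_pow N).fun_add (hasDerivAt_pow N t)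
  obtain ⟨d, hd⟩ :
      ∃ d, HasDerivAt (fun u : ℝ => ((1 - u) ^ N + u ^ N) ^ (-(1:ℝ) / N)) d t :=
    ⟨_, hQ.rpow_const (Or.inl hQpos.ne')⟩
  -- the two coordinates `x = (1 - u) λ`, `y = u λ` and their derivatives at `t`
  have hx : HasDerivAt (fun u : ℝ => (1 - u) * ((1 - u) ^ N + u ^ N) ^ (-(1:ℝ) / N))
      (-1 * ((1 - t) ^ N + t ^ N) ^ (-(1:ℝ) / N) + (1 - t) * d) t :=
    ((hasDerivAt_id' (x := t)).const_sub 1).fun_mul hd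
  have hy : HasDerivAt (fun u : ℝ => u * ((1 - u) ^ N + u ^ N) ^ (-(1:ℝ) / N))
      (1 * ((1 - t) ^ N + t ^ N) ^ (-(1:ℝ) / N) + t * d) t :=
    (hasDerivAt_id' (x := t)).fun_mul hd
  have h0 : deriv (fun u => γ.toFun u 0) t =
      ((-1 * ((1 - t) ^ N + t ^ N) ^ (-(1:ℝ) / N) + (1 - t) * d : ℝ) : ℂ) := by
    have hfun : (fun u => γ.toFun u 0) =
        fun u : ℝ => ((((1 - u) * ((1 - u) ^ N + u ^ N) ^ (-(1:ℝ) / N)) : ℝ) : ℂ) := by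
      funext u
      rw [hγ u]
      rfl
    rw [hfun]
    exact hx.ofReal_comp.deriv
  have h1 : deriv (fun u => γ.toFun u 1) t =
      ((1 * ((1 - t) ^ N + t ^ N) ^ (-(1:ℝ) / N) + t * d : ℝ) : ℂ) := by
    have hfun : (fun u => γ.toFun u 1) =
        fun u : ℝ => (((u * ((1 - u) ^ N + u ^ N) ^ (-(1:ℝ) / N)) : ℝ) : ℂ) := by
      funext u
      rw [hγ u]
      rfl
    rw [hfun]
    exact hy.ofReal_comp.deriv
  -- `Q^{-(r+s)/N} = λ^{r+s}`
  have hkey : ((1 - t) ^ N + t ^ N) ^ (-(((r + 1 : ℕ) : ℝ) + ((s + 1 : ℕ) : ℝ)) / N) =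
      (((1 - t) ^ N + t ^ N) ^ (-(1:ℝ) / N)) ^ (r + s + 2) := by
    rw [← Real.rpow_natCast _ (r + s + 2), ← Real.rpow_mul hQpos.le]
    congr 1
    push_cast
    ring
  rw [Fin.sum_univ_two, h0, h1, hγ t, hkey]
  simp only [Matrix.cons_val_zero, Matrix.cons_val_one, map_mul, map_pow, map_neg,
    MvPolynomial.eval_X]
  push_cast
  simp only [mul_pow]
  ring

end Summit.KontsevichZagierPeriods.FermatIsogeny.BetaLinearSector

end
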